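import Summits.Ventures.CertifiedManyBodySolver.Downfold.OneBandInPlane
import Literature.Analysis.ValidatedNumerics.BoxCover
import HarnessLib

/-!
# The direct one-band in-plane band, II: kernel-evaluable `ArithExpr` terms for the kd-tree box verifier

Venture CertifiedManyBodySolver, cell `pub/hubbard-downfold` (stage S1, technique B), seat hubbard-downfold-mod-4;
namespace `Summit.Ventures.CertifiedManyBodySolver.Downfold.Emery`. Everything PROVED; no number lives here. WHAT THIS
IS NOT: a statement about any material; `U = 0` one-body kinematics.

The polynomial form `ipBandUV S u v` of `OneBandInPlane`, its `u`-derivative `ipBandU` and the squared Fermi velocity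
`ipGradSqUV` are mirrored as `ArithExpr` terms of `Literature.Analysis.ValidatedNumerics.Certificate` in the variables
`0 ↦ u = cos kx`, `1 ↦ v = cos ky` (`ipBandE`, `ipBandUE`, `ipBandVE`, `ipGradSqE`, with `eval` lemmas), so that a
claim «expression ≤ b on a box of `(u, v)`» is discharged by the tree's kd-tree verifier
(`BoxCover.eval_le_of_kdCheck`; two-variable re-export `eval_le_of_kdCheck₂`).

Sources: `t–t′–t″` form [AndersenEtAl1995, §6]; natural interval extension and subdivision [Moore1966, Theorem 3.1, §4.4].
-/

noncomputable section

namespace Summit.Ventures.CertifiedManyBodySolver.Downfold.Emery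

open Real Literature.Analysis.ValidatedNumerics

/-! ## §4 `ArithExpr` terms for the kd-tree verifier (variables `0 ↦ u`, `1 ↦ v`) -/

/-- `T_m(e)` as an `ArithExpr`. [folklore] -/
def chebE (m : ℕ) (e : ArithExpr) : ArithExpr :=
  match m with
  | 0 => .const 1
  | 1 => e
  | 2 => .sub (.mul (.const 2) (.mul e e)) (.const 1)
  | 3 => .sub (.mul (.const 4) (.mul e (.mul e e))) (.mul (.const 3) e)
  | 4 => .add (.sub (.mul (.const 8) (.mul (.mul e e) (.mul e e))) (.mul (.const 8) (.mul e e))) (.const 1)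
  | _ => .const 0

/-- `T_m′(e)` as an `ArithExpr`. [folklore] -/
def dchebE (m : ℕ) (e : ArithExpr) : ArithExpr :=
  match m with
  | 1 => .const 1
  | 2 => .mul (.const 4) e
  | 3 => .sub (.mul (.const 12) (.mul e e)) (.const 3)
  | 4 => .sub (.mul (.const 32) (.mul e (.mul e e))) (.mul (.const 16) e)
  | _ => .const 0

/-- [folklore] -/
theorem eval_chebE (m : ℕ) (e : ArithExpr) (x : ℕ → ℝ) : (chebE m e).eval x = cheb m (e.eval x) := by
  match m with
  | 0 => simp [chebE, cheb]
  | 1 => simp [chebE, cheb]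
  | 2 => simp [chebE, cheb]; ring
  | 3 => simp [chebE, cheb]; ring
  | 4 => simp [chebE, cheb]; ring
  | k + 5 => simp [chebE, cheb]

/-- [folklore] -/
theorem eval_dchebE (m : ℕ) (e : ArithExpr) (x : ℕ → ℝ) : (dchebE m e).eval x = dcheb m (e.eval x) := by
  match m with
  | 0 => simp [dchebE, dcheb]
  | 1 => simp [dchebE, dcheb]
  | 2 => simp [dchebE, dcheb]
  | 3 => simp [dchebE, dcheb]; ring
  | 4 => simp [dchebE, dcheb]; ring
  | k + 5 => simp [dchebE, dcheb]

/-- Star polynomial as an `ArithExpr` in the sub-terms `eu, ev`. [folklore] -/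
def starE (m n : ℕ) (eu ev : ArithExpr) : ArithExpr :=
  if n = 0 then (if m = 0 then .const 1 else .mul (.const 2) (.add (chebE m eu) (chebE m ev)))
  else if m = n then .mul (.const 4) (.mul (chebE m eu) (chebE m ev))
  else .mul (.const 4) (.add (.mul (chebE m eu) (chebE n ev)) (.mul (chebE n eu) (chebE m ev)))

/-- `∂_u` star polynomial as an `ArithExpr`. [folklore] -/
def dstarUE (m n : ℕ) (eu ev : ArithExpr) : ArithExpr :=
  if n = 0 then (if m = 0 then .const 0 else .mul (.const 2) (dchebE m eu))
  else if m = n then .mul (.const 4) (.mul (dchebE m eu) (chebE m ev))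
  else .mul (.const 4) (.add (.mul (dchebE m eu) (chebE n ev)) (.mul (dchebE n eu) (chebE m ev)))

/-- [folklore] -/
theorem eval_starE (m n : ℕ) (eu ev : ArithExpr) (x : ℕ → ℝ) :
    (starE m n eu ev).eval x = starUV m n (eu.eval x) (ev.eval x) := by
  unfold starE starUV
  split_ifs <;> simp [eval_chebE]

/-- [folklore] -/
theorem eval_dstarUE (m n : ℕ) (eu ev : ArithExpr) (x : ℕ → ℝ) :
    (dstarUE m n eu ev).eval x = dstarU m n (eu.eval x) (ev.eval x) := by
  unfold dstarUE dstarU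
  split_ifs <;> simp [eval_chebE, eval_dchebE]

/-- The band polynomial in the sub-terms `eu, ev` as an `ArithExpr`. [folklore] -/
def ipBandGE (S : List (ℕ × ℕ × ℚ)) (eu ev : ArithExpr) : ArithExpr :=
  S.foldr (fun s acc => .add (.mul (.const s.2.2) (starE s.1 s.2.1 eu ev)) acc) (.const 0)

/-- `∂_u` band polynomial in the sub-terms `eu, ev` as an `ArithExpr`. [folklore] -/
def ipBandUGE (S : List (ℕ × ℕ × ℚ)) (eu ev : ArithExpr) : ArithExpr :=
  S.foldr (fun s acc => .add (.mul (.const s.2.2) (dstarUE s.1 s.2.1 eu ev)) acc) (.const 0)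

/-- [folklore] -/
theorem eval_ipBandGE (S : List (ℕ × ℕ × ℚ)) (eu ev : ArithExpr) (x : ℕ → ℝ) :
    (ipBandGE S eu ev).eval x = ipBandUV S (eu.eval x) (ev.eval x) := by
  induction S with
  | nil => simp [ipBandGE, ipBandUV]
  | cons s S ih =>
    simp only [ipBandGE, List.foldr_cons, ArithExpr.eval_add, ArithExpr.eval_mul, ArithExpr.eval_const,
      eval_starE, ipBandUV, List.map_cons, List.sum_cons] at ih ⊢
    rw [ih]

/-- [folklore] -/
theorem eval_ipBandUGE (S : List (ℕ × ℕ × ℚ)) (eu ev : ArithExpr) (x : ℕ → ℝ) :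
    (ipBandUGE S eu ev).eval x = ipBandU S (eu.eval x) (ev.eval x) := by
  induction S with
  | nil => simp [ipBandUGE, ipBandU]
  | cons s S ih =>
    simp only [ipBandUGE, List.foldr_cons, ArithExpr.eval_add, ArithExpr.eval_mul, ArithExpr.eval_const,
      eval_dstarUE, ipBandU, List.map_cons, List.sum_cons] at ih ⊢
    rw [ih]

/-- The band `ε(u, v)` on the variables `(x 0, x 1)`. [folklore] -/
def ipBandE (S : List (ℕ × ℕ × ℚ)) : ArithExpr := ipBandGE S (.var 0) (.var 1)

/-- `∂_u ε(u, v)` on `(x 0, x 1)`. [folklore] -/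
def ipBandUE (S : List (ℕ × ℕ × ℚ)) : ArithExpr := ipBandUGE S (.var 0) (.var 1)

/-- `∂_v ε(u, v) = ∂_u ε(v, u)` on `(x 0, x 1)`. [folklore] -/
def ipBandVE (S : List (ℕ × ℕ × ℚ)) : ArithExpr := ipBandUGE S (.var 1) (.var 0)

/-- `|∇ε|²(u, v)` on `(x 0, x 1)`. [folklore] -/
def ipGradSqE (S : List (ℕ × ℕ × ℚ)) : ArithExpr :=
  .add (.mul (.sub (.const 1) (.mul (.var 0) (.var 0))) (.mul (ipBandUE S) (ipBandUE S)))
    (.mul (.sub (.const 1) (.mul (.var 1) (.var 1))) (.mul (ipBandVE S) (ipBandVE S)))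

/-- [folklore] -/
@[simp] theorem eval_ipBandE (S : List (ℕ × ℕ × ℚ)) (x : ℕ → ℝ) :
    (ipBandE S).eval x = ipBandUV S (x 0) (x 1) := by
  simp [ipBandE, eval_ipBandGE]

/-- [folklore] -/
@[simp] theorem eval_ipBandUE (S : List (ℕ × ℕ × ℚ)) (x : ℕ → ℝ) :
    (ipBandUE S).eval x = ipBandU S (x 0) (x 1) := by
  simp [ipBandUE, eval_ipBandUGE]

/-- [folklore] -/
@[simp] theorem eval_ipBandVE (S : List (ℕ × ℕ × ℚ)) (x : ℕ → ℝ) :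
    (ipBandVE S).eval x = ipBandU S (x 1) (x 0) := by
  simp [ipBandVE, eval_ipBandUGE]

/-- [folklore] -/
@[simp] theorem eval_ipGradSqE (S : List (ℕ × ℕ × ℚ)) (x : ℕ → ℝ) :
    (ipGradSqE S).eval x = ipGradSqUV S (x 0) (x 1) := by
  simp [ipGradSqE, ipGradSqUV]; ring

/-- **Box claims by kd-tree**: a passing kd certificate for `e ≤ b` on the box `[ulo, uhi] × [vlo, vhi]` bounds
`e.eval` at every real point of the box (re-export of `eval_le_of_kdCheck` in the two-variable shape used here).
[cite: Moore1966, Theorem 3.1, §4.4] -/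
theorem eval_le_of_kdCheck₂ {e : ArithExpr} {b ulo uhi vlo vhi : ℚ} {t : KdCert ℕ}
    (h : t.check (exprLeOn e b) [(ulo, uhi), (vlo, vhi)] = true) {u v : ℝ}
    (hu : u ∈ Set.Icc (ulo : ℝ) uhi) (hv : v ∈ Set.Icc (vlo : ℝ) vhi) :
    e.eval (fun i => if i = 0 then u else if i = 1 then v else 0) ≤ b := by
  refine eval_le_of_kdCheck h _ ?_
  intro i
  match i with
  | 0 => simpa [Box.ivl] using hu
  | 1 => simpa [Box.ivl] using hv
  | k + 2 => simp [Box.ivl]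

end Summit.Ventures.CertifiedManyBodySolver.Downfold.Emery
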